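import Summits.QuantumFields.QCD.Theses.NestedDissectionSea
import Summits.QuantumFields.QCD.Theorems.CoerciveSea.Negative.CellDeterminants

/-!
# Route `NestedDissectionSea`, support item `DirichletDetReal` (stmt-QuantumFields-11275)

Every Dirichlet cell determinant of the `r = 1` Wilson–Dirac matrix in the fundamental `SU(3)`
representation is real.  Proof: γ₅-hermiticity `Γ₅ D Γ₅ = Dᴴ`
(`wilsonDirac_gammaFive_hermitian_holds`, Montvay–Münster (5.15)) restricts to every principal
submatrix because `Γ₅ = spinorLift γ₅` is diagonal, so `conj det D_c = det D_c`; this is the tree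
lemma `CoerciveSeaNegative.det_compressed_im` (any index predicate, any unitary colour
representation), specialised to the site predicate `p.1 ∈ c` and `fundamentalRep (Fin 3)`.
-/

namespace Summit.QuantumFields.QCD.Theorems

open Literature.MathematicalPhysics.QuantumLattice Literature.MathematicalPhysics.QuantumFieldTheory
  Literature.Probability.LatticeModels

/-- **Route item `DirichletDetReal`** (stmt-QuantumFields-11275): for every torus side `N`, every
`SU(3)` lattice gauge field `U`, every bare mass `μ` and every site set `c`, the determinant of the
`r = 1` Wilson–Dirac matrix (fundamental representation) restricted to the indices over `c` has
vanishing imaginary part — γ₅-hermiticity restricted to a principal block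
(`CoerciveSeaNegative.det_compressed_im`). -/
theorem dirichletDetReal_proof :
    Summit.QuantumFields.QCD.Theses.NestedDissectionSea.DirichletDetReal := by
  unfold Summit.QuantumFields.QCD.Theses.NestedDissectionSea.DirichletDetReal
  intro N _ U μ c
  classical
  exact CoerciveSeaNegative.det_compressed_im (fundamentalRep (Fin 3))
    fundamentalRep_mem_unitaryGroup U μ (fun p : TorusSite 4 N × Fin 3 × Fin 4 => p.1 ∈ c)

end Summit.QuantumFields.QCD.Theorems
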